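import Mathlib
import Literature.MathematicalPhysics.QuantumFieldTheory.Luscher2010.TrivializingMaps
import HarnessLib

/-!
# Lüscher 2010 — File B: the flow-action series (4.11)–(4.15), Wilson-loop actions and locality, finite-volume convergence (App. E), plaquette Laplacian, Euler step
M. Lüscher, *Trivializing maps, the Wilson flow and the HMC algorithm*, Commun. Math. Phys. 293 (2010)
899–919, arXiv:0907.5491 [Luscher2010Trivializing]. Statement-level typing (published definitions/results
only, each with its citation tag; nothing here is new mathematics). Authored by the pub-lqcd theory-1 seats
(cell lqcd-flow), file of record `HOME/lean/theory1/LuscherB_FlowActionSeries.lean`; imports file A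
(`Luscher2010/TrivializingMaps.lean`: `AmbConfig`, `SuBasis`, `linkDeriv`, `linkLap`, `luscherL`,
`trivialMeasure`, …).

HONEST FRAMING: exact (Metropolis-corrected) sampling algorithms for lattice gauge theory; figures
of merit are autocorrelation/cost numbers at stated couplings and volumes; no continuum-physics claim.

* `IsLuscherSeries` — the perturbative recursion (4.11)–(4.15) ("up to an irrelevant additive constant"),
  with the proved scaling lemma `IsLuscherSeries.smul` (`S ↦ βS` rescales order `k` by `β^{k+1}`);
  `IsHaarNormalised` — App. E.2's normalisation `P G φ = 0` at `t₀ = 0` (every order has zero mean for the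
  trivial measure), which fixes the constants and singles out App. E.3's series `∑ₙ (-t)ⁿ (G₀V)ⁿ G₀ S`.
* Wilson-loop actions (`PathWord`, `pathProd` = `U(C)`, `IsClosedWord`, `loopAction`): the printed hypothesis
  class of §4 ("a sum of Wilson loops (plaquettes, rectangles, etc.)").
* Locality vocabulary (`plaqLinks`, `plaqNbhd`, `linkBall`, `IsLocalSum`) and `LuscherSeriesLocal` — §4.5(b):
  for a Wilson-loop action the order-`k` term is a local sum whose range grows linearly in `k`, with a
  constant that does not depend on the lattice size.
* `SeriesConvergesFiniteVolume` — App. E: on every FINITE lattice the normalised series has a radius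
  `r(L) > 0` (nothing uniform in `L`; the printed infinite-volume caveat is quoted in the docstring).
* `PlaquetteLaplacian` — `Δ Re tr U_p = 4 C_F Re tr U_p` for `L ≥ 2` (behind (3.10) and (4.14)).
* `eulerStep` (5.1) and `EulerStepInvertible` (5.5)/App. D: `|ε| < 1/8`, `SU(3)`, `d = 4`, `L ≥ 2`.

Revision 2026-08-21 (answers the review of p245615): (1) `SeriesConvergesFiniteVolume` now carries the
App. E normalisation `IsHaarNormalised Sk` as a hypothesis — without it the recursion fixes each order only
up to an additive constant and the `∀`-form was refutable (`Sk k := (k!)²`); (2) `PlaquetteLaplacian` and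
(4) `EulerStepInvertible` carry `2 ≤ L` (on the one-site lattice a plaquette, resp. a staple, revisits the
differentiated link; the printed computations assume it does not); (3) `LuscherSeriesLocal` is restricted
to the printed hypothesis class (Wilson-loop actions) and its footprint constant is uniform in `L`.
-/

open MeasureTheory
open scoped ENNReal Matrix

namespace Literature.MathematicalPhysics.QuantumFieldTheory.Luscher2010

open Literature.MathematicalPhysics.QuantumFieldTheory

/-- Local notation for `SU(n) ⊆ M_n(ℂ)`, as in `WilsonFlow.lean`. [folklore] -/
local notation "SU[" n "]" => Matrix.specialUnitaryGroup (Fin n) ℂ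

noncomputable section

section Flows

variable {d L n : ℕ}

section Smooth

open scoped Matrix.Norms.Frobenius

/-- The **perturbative recursion** (4.11)–(4.15): a sequence `S̃^{(k)}` is a Lüscher series for `S` when
`Δ S̃^{(0)} = S + Ċ^{(0)}` and `Δ S̃^{(k)} = -∑_{x,μ} ∂^a S ∂^a S̃^{(k-1)} + Ċ^{(k)}` (`k ≥ 1`) on the field
manifold (`Δ = -∑ ∂^a∂^a = linkLap`), the constants removing the zero mode; "the solution … is obtained in
the form of sums of Wilson loops and products of Wilson loops", determined "up to an irrelevant additive
constant" (the normalisation that fixes it is `IsHaarNormalised`).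
[cite: Luscher2010Trivializing, §4.3 eqs. (4.11)–(4.15)] -/
def IsLuscherSeries [NeZero L] (B : SuBasis n) (S : AmbConfig d L n → ℝ)
    (Sk : ℕ → AmbConfig d L n → ℝ) (c : ℕ → ℝ) : Prop :=
  (∀ U : GaugeConfig d L SU[n], linkLap B (Sk 0) (WilsonFlow.coeConfig U) = S (WilsonFlow.coeConfig U) + c 0) ∧
  ∀ k, ∀ U : GaugeConfig d L SU[n],
    linkLap B (Sk (k + 1)) (WilsonFlow.coeConfig U) =
      -(∑ e : Edge d L, ∑ a : B.ι, linkDeriv e (B.T a) S (WilsonFlow.coeConfig U)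
          * linkDeriv e (B.T a) (Sk k) (WilsonFlow.coeConfig U)) + c (k + 1)

/-- **App. E's normalisation of the series** (App. E.2: the inverse `G` of `𝓛` is fixed by `𝓛Gφ = (1-P)φ`
and `P G φ = 0`, `P φ = (1,φ)/(1,1)`; at `t₀ = 0` the scalar product (4.7) is the trivial-measure one, so
`P₀` is the mean for `D[U]`): every order `S̃^{(k)}` has ZERO MEAN with respect to the trivial (product
Haar) measure. With this normalisation the Lüscher series is unique and is, term by term, App. E.3's series
`ψ_t = ∑ₙ (-t)ⁿ (G₀ 𝓥)ⁿ G₀ S` (`S̃^{(0)} = G₀S`, `S̃^{(k)} = -G₀ 𝓥 S̃^{(k-1)}`), whose convergence App. E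
proves. [cite: Luscher2010Trivializing, §4.2 eqs. (4.7), (4.9), App. E.2–E.3] -/
def IsHaarNormalised [NeZero L] (Sk : ℕ → AmbConfig d L n → ℝ) : Prop :=
  ∀ k, ∫ U, Sk k (WilsonFlow.coeConfig U) ∂(trivialMeasure SU[n] d L) = 0

/-- Link derivatives commute with constant factors (no differentiability needed: `deriv_const_mul_field`).
Private helper for `IsLuscherSeries.smul`. [folklore] -/
private theorem linkDeriv_const_mul (e : Edge d L) (X : Matrix (Fin n) (Fin n) ℂ) (a : ℝ)
    (f : AmbConfig d L n → ℝ) (W : AmbConfig d L n) :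
    linkDeriv e X (fun W' => a * f W') W = a * linkDeriv e X f W := by
  unfold linkDeriv
  exact deriv_const_mul_field a

/-- The link Laplacian commutes with constant factors. Private helper for `IsLuscherSeries.smul`.
[folklore] -/
private theorem linkLap_const_mul [NeZero L] (B : SuBasis n) (a : ℝ) (f : AmbConfig d L n → ℝ)
    (W : AmbConfig d L n) :
    linkLap B (fun W' => a * f W') W = a * linkLap B f W := by
  unfold linkLap
  have h : ∀ (e : Edge d L) (b : B.ι),
      linkDeriv e (B.T b) (linkDeriv e (B.T b) fun W' => a * f W') W =
        a * linkDeriv e (B.T b) (linkDeriv e (B.T b) f) W := by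
    intro e b
    have hfun : (linkDeriv e (B.T b) fun W' => a * f W') = fun W' => a * linkDeriv e (B.T b) f W' :=
      funext fun W' => linkDeriv_const_mul e (B.T b) a f W'
    rw [hfun, linkDeriv_const_mul]
  simp_rw [h, ← Finset.mul_sum]
  ring

/-- **Scaling of the Lüscher series with the coupling** (read off (4.14)–(4.17): `S̃^{(0)} ∝ β`,
`S̃^{(1)} ∝ β²`): if `(S̃^{(k)}, Ċ^{(k)})` is a Lüscher series for `S` then `(β^{k+1} S̃^{(k)}, β^{k+1} Ċ^{(k)})`
is one for `β S`. Hence for `S = β S_W` the flow action is `S̃_t = β ∑_k (tβ)^k s_k` with `β`-INDEPENDENT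
loop functionals `s_k`: the expansion parameter of the trivializing-flow series is `tβ`, i.e. at the
trivializing time `t = 1` it is a strong-coupling series in `β` (cf. §1: the map "moves the theory closer to
the strong-coupling limit"). PROVED (homogeneity of the recursion; no smoothness needed); the normalisation
is preserved too (`IsHaarNormalised.smul`). [cite: Luscher2010Trivializing, §4.3 eqs. (4.12)–(4.13),
§4.4 eqs. (4.14), (4.17)] -/
theorem IsLuscherSeries.smul [NeZero L] {B : SuBasis n} {S : AmbConfig d L n → ℝ}
    {Sk : ℕ → AmbConfig d L n → ℝ} {c : ℕ → ℝ} (h : IsLuscherSeries B S Sk c) (β : ℝ) :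
    IsLuscherSeries B (fun W => β * S W) (fun k W => β ^ (k + 1) * Sk k W)
      (fun k => β ^ (k + 1) * c k) := by
  refine ⟨fun U => ?_, fun k U => ?_⟩
  · rw [linkLap_const_mul, h.1 U]; ring
  · rw [linkLap_const_mul, h.2 k U]
    have hprod : ∀ (e : Edge d L) (a : B.ι),
        linkDeriv e (B.T a) (fun W => β * S W) (WilsonFlow.coeConfig U) *
            linkDeriv e (B.T a) (fun W => β ^ (k + 1) * Sk k W) (WilsonFlow.coeConfig U) =
          β ^ (k + 1 + 1) * (linkDeriv e (B.T a) S (WilsonFlow.coeConfig U) *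
            linkDeriv e (B.T a) (Sk k) (WilsonFlow.coeConfig U)) := by
      intro e a
      rw [linkDeriv_const_mul, linkDeriv_const_mul]
      ring
    simp_rw [hprod, ← Finset.mul_sum]
    ring

/-- The coupling rescaling `S̃^{(k)} ↦ β^{k+1} S̃^{(k)}` of `IsLuscherSeries.smul` preserves App. E's
normalisation (linearity of the integral). PROVED. [cite: Luscher2010Trivializing, §4.3 eqs. (4.12)–(4.13),
App. E.2] -/
theorem IsHaarNormalised.smul [NeZero L] {Sk : ℕ → AmbConfig d L n → ℝ} (h : IsHaarNormalised Sk)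
    (β : ℝ) : IsHaarNormalised (fun k W => β ^ (k + 1) * Sk k W) := by
  intro k
  simp only [integral_const_mul, h k, mul_zero]

/-! ### Wilson-loop actions — the hypothesis class of §4
§4, preamble: "Assuming that the gauge action S(U) is a sum of Wilson loops (plaquettes, rectangles, etc.)";
§4.4 eq. (4.19): "U(C) denotes the ordered product of the link variables along the loop C … The sums in these
equations extend over all possible positions of the loops on the lattice. Loops with opposite orientation are
considered to be different". -/

/-- A **lattice path word**: a finite sequence of steps `(μ, forward?)`; a loop shape `C` up to its
position. [folklore] -/
abbrev PathWord (d : ℕ) : Type := List (Fin d × Bool)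

/-- The **ordered product `U(C)`** of the (ambient) link variables along the path that starts at `x` and
follows the word `w`: a forward step in direction `μ` contributes `W(x,μ)` and moves to `x + μ̂`, a backward
step contributes `W(x - μ̂, μ)ᴴ` (`= U(x - μ̂, μ)⁻¹` on `SU(n)`) and moves to `x - μ̂`.
[cite: Luscher2010Trivializing, §4.4 eq. (4.19)] -/
def pathProd (W : AmbConfig d L n) : Site d L → PathWord d → Matrix (Fin n) (Fin n) ℂ
  | _, [] => 1
  | x, (μ, true) :: w => W (x, μ) * pathProd W (x.shift μ) w
  | x, (μ, false) :: w => (W (x - Pi.single μ 1, μ))ᴴ * pathProd W (x - Pi.single μ 1) w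

/-- A word is **closed** — it describes a lattice LOOP `C` in the sense of §4 ("Wilson loops (plaquettes,
rectangles, etc.)", "the ordered product of the link variables along the loop C") — when its net
displacement vanishes in `ℤ^d` (as many forward as backward steps in every direction), so that the path
returns to its starting point on every periodic lattice (loops closing only modulo `L`, i.e. Polyakov lines,
are not Wilson loops and are excluded). [cite: Luscher2010Trivializing, §4 (preamble), §4.4 eq. (4.19)] -/
def IsClosedWord (w : PathWord d) : Prop :=
  ∀ μ : Fin d, w.count (μ, true) = w.count (μ, false)

/-- A **Wilson-loop action** `S(U) = ∑_x ∑_{C ∈ 𝒞} Re (c_C tr U(C_x))`: a finite family `𝒞` of loop shapes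
with complex coefficients, summed over all positions `x` of the loops on the lattice — "a sum of Wilson loops
(plaquettes, rectangles, etc.)"; e.g. the plaquette action (4.16) `S_w = -(β/6) 𝒲₀` with
`𝒲₀ = ∑_C tr U(C)` over all oriented plaquette loops (4.19).
[cite: Luscher2010Trivializing, §4 (preamble), §4.4 eqs. (4.16), (4.19)] -/
def loopAction [NeZero L] (shapes : Finset (PathWord d)) (coef : PathWord d → ℂ) (W : AmbConfig d L n) : ℝ :=
  ∑ x : Site d L, ∑ w ∈ shapes, (coef w * (pathProd W x w).trace).re

/-! ### Locality vocabulary and §4.5(b) -/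

/-- The four links of the plaquette at `x` in the `(μ,ν)` plane. [folklore] -/
def plaqLinks (x : Site d L) (μ ν : Fin d) : Set (Edge d L) :=
  {(x, μ), (x.shift μ, ν), (x.shift ν, μ), (x, ν)}

/-- The plaquette-neighbourhood of a link: all links `e'` such that some plaquette contains both `e`
and `e'` (plumbing for `linkBall`; Set-valued). [folklore] -/
def plaqNbhd (e : Edge d L) : Set (Edge d L) :=
  {e' | ∃ (x : Site d L) (μ ν : Fin d), μ ≠ ν ∧ e ∈ plaqLinks x μ ν ∧ e' ∈ plaqLinks x μ ν}

/-- The ball of radius `R` around a link in the plaquette-adjacency graph (the "footprint" of a loop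
functional anchored at that link, in the words of §4.5(b)). [folklore] -/
def linkBall : ℕ → Edge d L → Set (Edge d L)
  | 0, e => {e}
  | R + 1, e => {e'' | ∃ e' ∈ linkBall R e, e'' = e' ∨ e'' ∈ plaqNbhd e'}

/-- `f` is a **local sum of range `R`** — the notion behind §4.5(b) "expansion in local terms whose
footprint on the lattice increases proportionally to the order k" (and §1, "local" actions), rendered
(our typing, via Mathlib's `DependsOn`) as: a sum over links of densities each depending only on the link
variables in the ball of radius `R` around its anchor. The Wilson plaquette action is a local sum of
range `1`; a constant is a local sum of every range. This is a DEFINITION used to state the cited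
assertion `LuscherSeriesLocal` below, not itself a claim.
[cite: Luscher2010Trivializing, §4.5(b) ("local terms whose footprint on the lattice …")] -/
def IsLocalSum [NeZero L] (R : ℕ) (f : AmbConfig d L n → ℝ) : Prop :=
  ∃ g : Edge d L → AmbConfig d L n → ℝ,
    (∀ e, DependsOn (g e) (linkBall R e)) ∧ f = fun W => ∑ e : Edge d L, g e W

/-- **Finite-order locality of the Lüscher series** (§4.5(b), first paragraph, verbatim: "The series
(4.11) is an expansion in local terms whose footprint on the lattice increases proportionally to the
order k. At the values of t, where the expansion converges, the action S̃_t is then guaranteed to be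
local as well."; mechanism §4.3/§4.5(a): for an action that is "a sum of Wilson loops" (§4 preamble) the
order-`k` term is obtained by contracting the loops of `S` with those of order `k-1` at a common link and
inverting `Δ`, which acts algebraically on loop functionals, so the solution is a sum of "Wilson loops and
products of Wilson loops" fitting in a region whose size grows linearly with `k`). Rendered, for the
PRINTED hypothesis class only: for every Wilson-loop action (finite family of closed loop shapes with
coefficients) there is a constant `C` — depending on `d`, `n` and the loop shapes but NOT on the lattice
size, the footprint being a property of the loop expressions — such that on every periodic lattice the
recursion has a smooth, Haar-normalised solution whose order-`k` term is a local sum of range `≤ C (k+1)`.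
(The paper gives proportionality, not the constant; the sharper reading `range ≤ 1 + k` for the plaquette
action, and any statement for general smooth local actions, are OURS and live on the venture side; the
algebraic form "sums of products of Wilson loops" is not typed here.) PROOF STATUS in print: asserted with
the mechanism, no formal proof; provable (venture target).
[cite: Luscher2010Trivializing, §4 (preamble), §4.3 eqs. (4.14)–(4.15), §4.5(a)–(b)] -/
def LuscherSeriesLocal (d n : ℕ) : Prop :=
  ∀ (shapes : Finset (PathWord d)) (coef : PathWord d → ℂ), (∀ w ∈ shapes, IsClosedWord w) →
    ∃ C : ℕ, ∀ (L : ℕ) [NeZero L] (B : SuBasis n),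
      ∃ (Sk : ℕ → AmbConfig d L n → ℝ) (c : ℕ → ℝ),
        IsLuscherSeries B (loopAction shapes coef) Sk c ∧ IsHaarNormalised Sk ∧
        (∀ k, ContDiff ℝ (⊤ : ℕ∞) (Sk k)) ∧ ∀ k, IsLocalSum (C * (k + 1)) (Sk k)

/-- **Finite-volume convergence of the `t`-expansion** (§4.3–4.5(b), App. E.3 at `t₀ = 0`): on a FIXED
finite lattice the Haar-normalised series `S̃_t = ∑ t^k S̃^{(k)}` (`= ∑ₙ (-t)ⁿ(G₀𝓥)ⁿG₀S`, App. E.3) has a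
non-zero radius of convergence `r`: for `|t| < r` the series and its link derivatives converge absolutely
(and uniformly — the norm estimates (E.9)/(E.13) are geometric, Sobolev's lemma gives pointwise bounds),
the constants `Ċ^{(k)}` sum to `Ċ_t`, and the sum solves the Laplace equation (4.5), `𝓛_t S̃_t = S + Ċ_t`.
The NORMALISATION hypothesis is essential: the recursion alone fixes each order only up to an additive
constant. Printed caveat, verbatim: "The norm estimates in appendix E imply a lower bound on the
convergence radius of the series, but this bound is rather poor and vanishes in the infinite-volume limit."
The volume-UNIFORM statement is OPEN (§4.5(b)) and is NOT asserted here.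
[cite: Luscher2010Trivializing, §4.3, §4.5(b), App. E.2–E.3] -/
def SeriesConvergesFiniteVolume (d L n : ℕ) : Prop :=
  ∀ [NeZero L] (B : SuBasis n) (S : AmbConfig d L n → ℝ) (Sk : ℕ → AmbConfig d L n → ℝ) (c : ℕ → ℝ),
    ContDiff ℝ (⊤ : ℕ∞) S → (∀ k, ContDiff ℝ (⊤ : ℕ∞) (Sk k)) → IsLuscherSeries B S Sk c →
    IsHaarNormalised Sk →
    ∃ r > 0, ∀ t : ℝ, |t| < r →
      (∀ U : GaugeConfig d L SU[n], Summable fun k => |t| ^ k * |Sk k (WilsonFlow.coeConfig U)|) ∧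
      (∀ (U : GaugeConfig d L SU[n]) e (a : B.ι),
        Summable fun k => |t| ^ k * |linkDeriv e (B.T a) (Sk k) (WilsonFlow.coeConfig U)|) ∧
      (Summable fun k => |t| ^ k * |c k|) ∧
      ∀ U : GaugeConfig d L SU[n],
        luscherL B S t (fun W => ∑' k, t ^ k * Sk k W) (WilsonFlow.coeConfig U) =
          S (WilsonFlow.coeConfig U) + ∑' k, t ^ k * c k

end Smooth

/-- **The Laplacian on a plaquette** (the computation behind (3.10) and (4.14)): with `tr T^aT^b = -½δ^{ab}`,
`∑_a T^aT^a = -C_F·1`, `C_F = (n²-1)/(2n)`, and — on a lattice with `L ≥ 2` — the four links of a plaquette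
being DISTINCT, each visited once, `Δ Re tr U_p = 4 C_F Re tr U_p` (`= (16/3) Re tr U_p` for `SU(3)`; the
smallest non-zero eigenvalue of `Δ` is `C_F = 4/3`). (On the one-site lattice `L = 1` the links `(x,μ)` and
`(x+ν̂,μ)` coincide, the plaquette revisits them and the identity fails — cross terms; the hypothesis `2 ≤ L`
is exactly the distinctness the printed computation uses.) Consequences printed: `S̃^{(0)} = Δ⁻¹ S = (3/16) S`
for the `SU(3)` Wilson action — "to this order and up to a rescaling of the time parameter, the trivializing
flow in the Wilson theory thus coincides with the Wilson flow" (4.14) — and `ln det 𝓕_{t*} = -(16/3) ∫₀ᵗ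
S_w(U_s) ds` for the Wilson flow (3.10). (Provable: a build-phase target, cited until then.)
[cite: Luscher2010Trivializing, §3.2 eq. (3.10), §4.3 eq. (4.14), App. A eq. (A.5)] -/
def PlaquetteLaplacian (d L n : ℕ) : Prop :=
  ∀ [NeZero L], 2 ≤ L → ∀ (B : SuBasis n) (U : GaugeConfig d L SU[n]) (x : Site d L) (μ ν : Fin d), μ ≠ ν →
    linkLap B (fun W => (W (x, μ) * W (x.shift μ, ν) * (W (x.shift ν, μ))ᴴ * (W (x, ν))ᴴ).trace.re)
        (WilsonFlow.coeConfig U) =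
      4 * (((n : ℝ) ^ 2 - 1) / (2 * n)) *
        (((plaquetteHolonomy U x μ ν : SU[n]) : Matrix (Fin n) (Fin n) ℂ)).trace.re

/-- The one-link **Euler (stout) step** `U(x,μ) → e^{ε[Z(U)](x,μ)} U(x,μ)` of the Wilson flow (eq. (5.1); `n`
Euler sweeps at fixed `t = nε` converge to `wilsonFlow t`). [cite: Luscher2010Trivializing, §5.1 eq. (5.1),
§5.3 eq. (5.8)] -/
def eulerStep (ε : ℝ) (e : Edge d L) (W : AmbConfig d L n) : AmbConfig d L n :=
  Function.update W e (NormedSpace.exp ((ε : ℂ) • wilsonGenerator 0 W e) * W e)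

/-- **Invertibility of the Euler step** (§5.2 eq. (5.5), App. D; gauge group `SU(3)`): for `|ε| < 1/8` the
one-link step (5.1) has, for arbitrary values of the other link variables, a unique pre-image in `SU(3)`,
obtained by the fixed-point iteration (5.6), which converges at an exponential rate (contraction constant
`k = 8|ε|`, App. D.2), and its Jacobian is strictly positive (App. D.3); Euler sweeps are therefore
orientation-preserving diffeomorphisms of the field manifold. Rendered: the step restricts to a BIJECTION of
`SU(3)^E`, in the printed setting `d = 4`. HYPOTHESIS `2 ≤ L`: the constant `k = 8|ε| = 2(d-1)·(4/3)|ε|` is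
obtained (App. D.2, from (D.5)) by bounding each of the `2(d-1) = 6` terms `U(x,μ)·(staple)` of `Ω_{x,μ}`
separately, which requires that no staple contains the updated variable `U(x,μ)` itself; on `(ℤ/L)⁴` this
holds iff `L ≥ 2` (for `L = 1` the staples contain `U(x,μ)⁻¹`; coincidences AMONG the six staples, as for
`L = 2`, do not affect the term-by-term bound). Other `d` and `L = 1` are not asserted. (Provable in the
tree's style via `ContractingWith` — a build-phase target, cited until then.)
[cite: Luscher2010Trivializing, §5.2 eqs. (5.5)–(5.6), App. D eqs. (D.5)–(D.9)] -/
def EulerStepInvertible (L : ℕ) : Prop :=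
  ∀ [NeZero L], 2 ≤ L → ∀ (ε : ℝ), |ε| < 1 / 8 → ∀ e : Edge 4 L,
    ∃ Ψ : GaugeConfig 4 L SU[3] ≃ GaugeConfig 4 L SU[3],
      ∀ U, WilsonFlow.coeConfig (Ψ U) = eulerStep ε e (WilsonFlow.coeConfig U)

end Flows

end

end Literature.MathematicalPhysics.QuantumFieldTheory.Luscher2010
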